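import Mathlib
import Literature.Computability.Complexity.CircuitLightCone
import Literature.Computability.Complexity.BlockSensitivity
import Literature.Computability.MetaComplexity.MCSP
import Literature.Computability.MetaComplexity.TruthTablesProofs
import Literature.Computability.MetaComplexity.MCSPStatisticalTest
import Literature.Computability.MetaComplexity.FormulaModelsAE
import Literature.Computability.MetaComplexity.GapMCSPLightConeLowerBound
import Literature.Computability.MetaComplexity.OliveiraPichSanthanam2019.GapMCSPMagnification
import Literature.Computability.MetaComplexity.ChenLiYang2022.ProbabilisticCircuits
import HarnessLib

/-!
# A PROBABILISTIC `B₂` circuit for `MCSP[θ]` has at least `(1 − 2ε)(N − O(θ log(n+θ))) − 1` gates: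
# the sensitivity light cone (folklore, kernel-checked; census row R10, known column)

Folklore, fully proved (no named facts). Row R10 of the hardness-magnification gap census is
Chen–Li–Yang, *Extremely efficient constructions of hash functions, with applications to hardness
magnification and PRFs*, CCC 2022 (LIPIcs 234, Art. 23), Thm. 1.6 (p. 7; tree fact
`ChenLiYang2022.thm16`, hypothesis `ChenLiYang2022.Hypothesis16 β`): *"Let N = 2ⁿ … and
n ≤ s(n) ≤ n²/log n be any size function. If MCSP[s(n)] does not have probabilistic circuits of
size 2N + O(N/log log N), then there exists some c > 0 such that ⊕P ⊈ SIZE[2^{N^c}]"*, where a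
probabilistic circuit is a distribution over `B₂` circuits erring with probability `≤ 1/poly(N)` on
every input (§1.2.1 p. 5, §2.2 p. 13; the tree's `ChenLiYang2022.PSIZEae ε s`). Its KNOWN column is
empty in print: *"We leave proving an unconditional 2n − o(n) circuit size lower bound for MCSP,
even against deterministic circuits, as an interesting open problem"* (p. 7, L19–20 of the held text
`paper:doi-10-4230-lipics-ccc-2022-23`). The DETERMINISTIC folklore bound `N − o(N)` is the tree's
`MCSPSize_not_mem_SIZEae_sublinear` (`GapMCSPLightConeLowerBound.lean`, fibre counting over the
light cone), but fibre counting says nothing about distributions over circuits (`SIZEae ⊆ PSIZEae`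
is the wrong direction, and for GAP versions `MCSP[a, b]` with `b − a ≥ n` a random half of the
truth table does decide the promise information-theoretically). This file proves the probabilistic
bound by the circuit analogue of Nisan's randomized decision-tree argument (`bs(f) ≤ R_ε(f)/(1−2ε)`,
Nisan, SIAM J. Comput. 20 (1991); Buhrman–de Wolf, TCS 288 (2002) Thm. 16; the tree's
`Complexity/NisanRandomizedLowerBound.lean`), with single-bit SENSITIVITY in place of block
sensitivity and the LIGHT CONE in place of the queried path:

* **Flip closure** (`apply_flipBlock_eq_of_subset`, `two_pow_card_le_card_filter_apply_eq`): if a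
  Boolean function `f` on `{0,1}^N` is invariant under flipping each coordinate of a set `I`
  EVERYWHERE, it is invariant under flipping any `T ⊆ I`, so every fibre of `f` has `≥ 2^{|I|}` points
  (`T ↦ z^T` is injective, `flipBlock_injective`). Hence at most `log₂ |f⁻¹(f z)|` coordinates are
  nowhere sensitive.
* **A boundary pair forces reading** (`PMF.toOuterMeasure_not_mem_lightCone_le`): if a distribution
  `μ` over circuits errs with probability `≤ ε` on `x` and on `x^i` and `f(x^i) ≠ f(x)`, then
  `Pr_μ[i ∉ lightCone C] ≤ 2ε` (a circuit not reading `i` answers `x` and `x^i` alike,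
  `Circuit.eval_congr_lightCone`; union bound on the two error events).
* **Expected cone size** (`PMF.card_sub_le_sum_toOuterMeasure_not_mem_lightCone`): if every circuit
  in the support of `μ` is a `B₂` circuit with `≤ s` gates, it reads `≤ s + 1` inputs
  (`Circuit.card_lightCone_le_size_succ`), so for every set `J` of coordinates
  `∑_{i ∈ J} Pr_μ[i ∉ lightCone C] ≥ |J| − (s + 1)`.
* **Pointwise theorem** (`PMF.card_sub_log_sub_le_of_error`): hence
  `N − log₂|f⁻¹(f z)| − (s + 1) ≤ 2ε·N` for every `z` — i.e. `s ≥ (1 − 2ε)·(# somewhere-sensitive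
  coordinates) − 1`, the probabilistic form of "a function depending on `m` variables needs `m − 1`
  fan-in-2 gates".
* **Family form for `MCSP[θ]`** (`MCSPSize_not_mem_PSIZEae`, real-error form
  `MCSPSize_not_mem_PSIZEae_ofReal`): with `z` the truth table of `v ↦ v₀` (complexity `0`) and the
  tree's count `|MCSP[θ] ∩ {0,1}^{2ⁿ}| ≤ (θ+1)(16(n+θ+1)²)^θ(n+θ+1)` (`card_filter_circuitSizeOver_le`),
  `MCSP[θ] ∉ PSIZEae ε s` as soon as infinitely often
  `2·ε(N)·N + log₂ count + s(N) + 1 < N` (`N = 2ⁿ`).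
* **Numerics of row R10** (`MCSPSize_not_mem_PSIZEae_linear`): for every `θ` with eventually
  `θ n ≤ ⌈2^{βn}⌉` for some `β < 1` (every `θ = 2^{o(n)}`, in particular the row's `⌊n^β⌋`), every
  real `c > 0` and every `κ < 1`: **`MCSP[θ] ∉ PSIZEae (N^{−c}) (⌊κN⌋)`** — no probabilistic `B₂`
  circuits of `κN` gates with error `N^{−c}`, for all large `N`, decide `MCSP[θ]` (the bound fails at
  infinitely many lengths, all a family statement can say); sharper, with the dependence on the
  error exponent explicit (`MCSPSize_not_mem_PSIZEae_sublinear`): **`∉ PSIZEae (N^{−c}) (N − ⌈N^{β'}⌉)`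
  for every `β'` with `max(β, 1 − c) < β' < 1`**. NEEDED (R10, `Hypothesis16 β`):
  `∉ PSIZEae (N^{−c}) (2N + C·N/log log N)` for every `c > 0` and every `C`. The error conventions
  agree (`ChenLiYang2022.invPoly c`, every `c > 0`, on both sides); the distance between the
  kernel-checked known bound and the magnification threshold is the LEADING CONSTANT: `1 − o(1)`
  known, `2 + o(1)` needed (the census part
  `MagnificationGapCensus/ProbabilisticAndAlmostFormulaKnown.lean` records the cell next to the row).

Rendering notes. (i) Everything is stated for the tree's `PFamilyAE` / `PSIZEae` (error bound at
every input and every length, support constraint at all large lengths), the class of the typed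
hypothesis. (ii) No threshold is minted: the statements are quantified over all `κ < 1`, all `c > 0`
(the range the averaging gives; at `ε ≥ 1/2` or `κ ≥ 1` the argument is void — a coin, resp. the
trivial bound). (iii) The device is specific to EXACT thresholds: for `MCSP[a, b]` with `b ≥ a + n`
no two truth tables at Hamming distance `1` lie on opposite sides of the promise (patching one value
costs `≤ n` gates), so no boundary pair exists and nothing is claimed for the census's gap rows.
(iv) Why print calls such bounds folklore and why it is nevertheless recorded as a THEOREM: the
argument is the generic "sensitive coordinates must be read" count; no statement of it for
probabilistic circuits and `MCSP` was found in the held corpus or in the galaxy corpora (census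
FRESHNESS §typer1-g10), and CLY p. 7 records even the deterministic `2N − o(N)` bound as open.

References: [cite: ChenLiYang2022, Thm. 1.6 (p. 7), §2.2 (probabilistic B₂ circuits), p. 7 L19–20
(open problem)]; [cite: Nisan1991, Thm. (bs ≤ 3R)]; [cite: Wolf2002, Thm. 16]; [cite: AroraBarak2009,
Thm. 6.21 (counting circuits)]; [cite: BravyiGossetKonigScience2018, §2 Eq. (5) (light cones)];
[cite: Jukna2012, §1.2 (B₂, size)].
-/

namespace Literature.Computability.Complexity

open Finset
open scoped ENNReal

variable {N : ℕ}

/-! ### Flip closure: nowhere-sensitive coordinates are few -/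

/-- `T ↦ z^T` (flip the block `T` of `z`) is injective. [folklore] -/
theorem flipBlock_injective (z : Fin N → Bool) : Function.Injective (flipBlock z) := by
  intro T T' h
  ext i
  have hi := congrFun h i
  by_cases hT : i ∈ T
  · by_cases hT' : i ∈ T'
    · simp [hT, hT']
    · rw [flipBlock_apply_of_mem hT, flipBlock_apply_of_not_mem hT'] at hi
      cases hz : z i <;> simp [hz] at hi
  · by_cases hT' : i ∈ T'
    · rw [flipBlock_apply_of_not_mem hT, flipBlock_apply_of_mem hT'] at hi
      cases hz : z i <;> simp [hz] at hi
    · simp [hT, hT']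

/-- **Flip closure.** If `f` is invariant under flipping each single coordinate of `I` (at every
input), then `f` is invariant under flipping any block `T ⊆ I`. [folklore] -/
theorem apply_flipBlock_eq_of_subset {f : (Fin N → Bool) → Bool} {I : Finset (Fin N)}
    (hI : ∀ i ∈ I, ∀ x, f (flipBlock x {i}) = f x) (z : Fin N → Bool) :
    ∀ T : Finset (Fin N), T ⊆ I → f (flipBlock z T) = f z := by
  classical
  intro T
  induction T using Finset.induction_on with
  | empty => intro; simp
  | insert a T ha ih =>
    intro hT
    have haI : a ∈ I := hT (Finset.mem_insert_self a T)
    have hTI : T ⊆ I := (Finset.subset_insert a T).trans hT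
    have hsd : insert a T \ {a} = T := by
      ext j
      by_cases hj : j = a
      · subst hj; simp [ha]
      · simp [hj]
    have key : flipBlock (flipBlock z (insert a T)) {a} = flipBlock z T := by
      rw [flipBlock_flipBlock_of_subset
        (Finset.singleton_subset_iff.2 (Finset.mem_insert_self a T)), hsd]
    calc f (flipBlock z (insert a T)) = f (flipBlock (flipBlock z (insert a T)) {a}) :=
          (hI a haI _).symm
      _ = f (flipBlock z T) := by rw [key]
      _ = f z := ih hTI

/-- **Nowhere-sensitive coordinates are few**: if `f` is invariant under flipping each coordinate
of `I` everywhere, then the fibre of `f` through any `z` has at least `2 ^ |I|` points (the points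
`z^T`, `T ⊆ I`). [folklore] -/
theorem two_pow_card_le_card_filter_apply_eq {f : (Fin N → Bool) → Bool} {I : Finset (Fin N)}
    (hI : ∀ i ∈ I, ∀ x, f (flipBlock x {i}) = f x) (z : Fin N → Bool) :
    2 ^ I.card ≤ #{x : Fin N → Bool | f x = f z} := by
  classical
  calc 2 ^ I.card = I.powerset.card := (Finset.card_powerset I).symm
    _ = (I.powerset.image (flipBlock z)).card :=
        (Finset.card_image_of_injective _ (flipBlock_injective z)).symm
    _ ≤ #{x : Fin N → Bool | f x = f z} := Finset.card_le_card fun x hx => by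
        obtain ⟨T, hT, rfl⟩ := Finset.mem_image.1 hx
        simp only [Finset.mem_filter, Finset.mem_univ, true_and]
        exact apply_flipBlock_eq_of_subset hI z T (Finset.mem_powerset.1 hT)

/-! ### Probabilistic circuits must read every somewhere-sensitive coordinate -/

/-- **A boundary pair forces reading** (Nisan's observation, circuit form). If the distribution
`μ` over circuits errs on `f` with probability `≤ ε` at `x` and at `x^i`, and `f (x^i) ≠ f x`, then
`Pr_μ[i ∉ lightCone C] ≤ 2ε`: a circuit whose light cone misses `i` gives the same answer on `x`
and `x^i` (`Circuit.eval_congr_lightCone`), so it errs on one of them. [folklore] -/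
theorem PMF.toOuterMeasure_not_mem_lightCone_le (μ : PMF (Circuit (Fin N))) {ε : ℝ≥0∞}
    {f : (Fin N → Bool) → Bool} (herr : ∀ x, μ.toOuterMeasure {C | C.eval x ≠ f x} ≤ ε)
    {x : Fin N → Bool} {i : Fin N} (hx : f (flipBlock x {i}) ≠ f x) :
    μ.toOuterMeasure {C | i ∉ C.lightCone} ≤ 2 * ε := by
  classical
  have hsub : {C : Circuit (Fin N) | i ∉ C.lightCone} ⊆
      {C | C.eval x ≠ f x} ∪ {C | C.eval (flipBlock x {i}) ≠ f (flipBlock x {i})} := by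
    intro C hC
    simp only [Set.mem_setOf_eq, Set.mem_union] at hC ⊢
    by_contra h
    push Not at h
    have heq : C.eval (flipBlock x {i}) = C.eval x :=
      C.eval_congr_lightCone fun j hj =>
        flipBlock_apply_of_not_mem fun hji => hC (Finset.mem_singleton.1 hji ▸ hj)
    exact hx (h.2.symm.trans (heq.trans h.1))
  calc μ.toOuterMeasure {C | i ∉ C.lightCone}
      ≤ μ.toOuterMeasure
          ({C | C.eval x ≠ f x} ∪ {C | C.eval (flipBlock x {i}) ≠ f (flipBlock x {i})}) :=
        μ.toOuterMeasure.mono hsub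
    _ ≤ μ.toOuterMeasure {C | C.eval x ≠ f x} +
          μ.toOuterMeasure {C | C.eval (flipBlock x {i}) ≠ f (flipBlock x {i})} :=
        MeasureTheory.measure_union_le _ _
    _ ≤ ε + ε := add_le_add (herr _) (herr _)
    _ = 2 * ε := (two_mul ε).symm

/-- **Expected number of unread coordinates.** If every circuit in the support of `μ` is a `B₂`
circuit with `≤ s` gates (hence reads `≤ s + 1` inputs, `Circuit.card_lightCone_le_size_succ`), then
for every set `J` of coordinates `∑_{i ∈ J} Pr_μ[i ∉ lightCone C] ≥ |J| − (s + 1)`. [folklore] -/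
theorem PMF.card_sub_le_sum_toOuterMeasure_not_mem_lightCone (μ : PMF (Circuit (Fin N)))
    {s : ℕ} (hμ : ∀ C ∈ μ.support, C.IsOver B2 ∧ C.size ≤ s) (J : Finset (Fin N)) :
    ((J.card - (s + 1) : ℕ) : ℝ≥0∞) ≤ ∑ i ∈ J, μ.toOuterMeasure {C | i ∉ C.lightCone} := by
  classical
  simp_rw [PMF.toOuterMeasure_apply]
  rw [← Summable.tsum_finsetSum (fun _ _ => ENNReal.summable)]
  have hpt : ∀ C : Circuit (Fin N),
      ((J.card - (s + 1) : ℕ) : ℝ≥0∞) * μ C ≤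
        ∑ i ∈ J, ({C : Circuit (Fin N) | i ∉ C.lightCone}).indicator (⇑μ) C := by
    intro C
    have hsum : ∑ i ∈ J, ({C : Circuit (Fin N) | i ∉ C.lightCone}).indicator (⇑μ) C =
        ((J.filter fun i => i ∉ C.lightCone).card : ℝ≥0∞) * μ C := by
      rw [← Finset.sum_filter_add_sum_filter_not J (fun i => i ∉ C.lightCone)]
      have h1 : ∑ i ∈ J.filter (fun i => i ∉ C.lightCone),
          ({C : Circuit (Fin N) | i ∉ C.lightCone}).indicator (⇑μ) C =
          ∑ i ∈ J.filter (fun i => i ∉ C.lightCone), μ C :=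
        Finset.sum_congr rfl fun i hi => by
          rw [Set.indicator_of_mem]
          exact (Finset.mem_filter.1 hi).2
      have h2 : ∑ i ∈ J.filter (fun i => ¬ (i ∉ C.lightCone)),
          ({C : Circuit (Fin N) | i ∉ C.lightCone}).indicator (⇑μ) C = 0 :=
        Finset.sum_eq_zero fun i hi => by
          rw [Set.indicator_of_notMem]
          exact (Finset.mem_filter.1 hi).2
      rw [h1, h2, add_zero, Finset.sum_const, nsmul_eq_mul]
    rw [hsum]
    by_cases hC : C ∈ μ.support
    · obtain ⟨hB, hsz⟩ := hμ C hC
      have hcone : (J.filter fun i => i ∈ C.lightCone).card ≤ s + 1 :=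
        (Finset.card_le_card fun i hi => (Finset.mem_filter.1 hi).2).trans
          ((C.card_lightCone_le_size_succ hB).trans (by omega))
      have hsplit :
          (J.filter fun i => i ∈ C.lightCone).card +
            (J.filter fun i => ¬ (i ∈ C.lightCone)).card = J.card :=
        Finset.card_filter_add_card_filter_not _
      have hle : J.card - (s + 1) ≤ (J.filter fun i => i ∉ C.lightCone).card := by
        have : (J.filter fun i => ¬ (i ∈ C.lightCone)) = (J.filter fun i => i ∉ C.lightCone) :=
          rfl
        omega
      gcongr
    · have h0 : μ C = 0 := by rwa [PMF.mem_support_iff, not_not] at hC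
      simp [h0]
  calc ((J.card - (s + 1) : ℕ) : ℝ≥0∞) = ((J.card - (s + 1) : ℕ) : ℝ≥0∞) * ∑' C, μ C := by
        rw [PMF.tsum_coe, mul_one]
    _ = ∑' C, ((J.card - (s + 1) : ℕ) : ℝ≥0∞) * μ C := ENNReal.tsum_mul_left.symm
    _ ≤ ∑' C, ∑ i ∈ J, ({C : Circuit (Fin N) | i ∉ C.lightCone}).indicator (⇑μ) C :=
        ENNReal.tsum_le_tsum hpt

/-- **The sensitivity light cone (pointwise theorem).** If a distribution `μ` over `B₂` circuits
with `≤ s` gates computes `f : {0,1}^N → {0,1}` with error `≤ ε` at every input, then for every `z`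
`N − log₂ |f⁻¹(f z)| − (s + 1) ≤ 2ε·N`: all but `log₂ |f⁻¹(f z)|` coordinates are somewhere sensitive
(`two_pow_card_le_card_filter_apply_eq`), each is read with probability `≥ 1 − 2ε`
(`PMF.toOuterMeasure_not_mem_lightCone_le`), and on average at most `s + 1` are read
(`PMF.card_sub_le_sum_toOuterMeasure_not_mem_lightCone`). [folklore] -/
theorem PMF.card_sub_log_sub_le_of_error (μ : PMF (Circuit (Fin N))) {s : ℕ} {ε : ℝ≥0∞}
    (hμ : ∀ C ∈ μ.support, C.IsOver B2 ∧ C.size ≤ s) {f : (Fin N → Bool) → Bool}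
    (herr : ∀ x, μ.toOuterMeasure {C | C.eval x ≠ f x} ≤ ε) (z : Fin N → Bool) :
    ((N - Nat.log 2 #{x : Fin N → Bool | f x = f z} - (s + 1) : ℕ) : ℝ≥0∞) ≤ 2 * ε * N := by
  classical
  -- the nowhere-sensitive coordinates `I` and their complement `J`
  set I : Finset (Fin N) := Finset.univ.filter fun i => ∀ x, f (flipBlock x {i}) = f x with hIdef
  have hI : ∀ i ∈ I, ∀ x, f (flipBlock x {i}) = f x := fun i hi => (Finset.mem_filter.1 hi).2
  have hIcard : I.card ≤ Nat.log 2 #{x : Fin N → Bool | f x = f z} :=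
    Nat.le_log_of_pow_le (by norm_num) (two_pow_card_le_card_filter_apply_eq hI z)
  set J : Finset (Fin N) := Iᶜ with hJdef
  have hJcard : J.card = N - I.card := by rw [hJdef, Finset.card_compl, Fintype.card_fin]
  have hJN : J.card ≤ N := (Finset.card_le_univ J).trans_eq (Fintype.card_fin N)
  have hJ : ∀ i ∈ J, ∃ x, f (flipBlock x {i}) ≠ f x := by
    intro i hi
    rw [hJdef, Finset.mem_compl, hIdef, Finset.mem_filter] at hi
    push Not at hi
    exact hi (Finset.mem_univ i)
  have hup : ∑ i ∈ J, μ.toOuterMeasure {C | i ∉ C.lightCone} ≤ J.card * (2 * ε) :=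
    calc ∑ i ∈ J, μ.toOuterMeasure {C | i ∉ C.lightCone} ≤ ∑ i ∈ J, 2 * ε :=
          Finset.sum_le_sum fun i hi => by
            obtain ⟨x, hx⟩ := hJ i hi
            exact PMF.toOuterMeasure_not_mem_lightCone_le μ herr hx
      _ = J.card * (2 * ε) := by rw [Finset.sum_const, nsmul_eq_mul]
  have hle : N - Nat.log 2 #{x : Fin N → Bool | f x = f z} - (s + 1) ≤ J.card - (s + 1) := by
    omega
  calc ((N - Nat.log 2 #{x : Fin N → Bool | f x = f z} - (s + 1) : ℕ) : ℝ≥0∞)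
      ≤ ((J.card - (s + 1) : ℕ) : ℝ≥0∞) := by exact_mod_cast hle
    _ ≤ ∑ i ∈ J, μ.toOuterMeasure {C | i ∉ C.lightCone} :=
        PMF.card_sub_le_sum_toOuterMeasure_not_mem_lightCone μ hμ J
    _ ≤ J.card * (2 * ε) := hup
    _ ≤ (N : ℝ≥0∞) * (2 * ε) := by gcongr
    _ = 2 * ε * N := mul_comm _ _

end Literature.Computability.Complexity

namespace Literature.Computability.MetaComplexity

open Filter Finset Literature.Computability.Complexity
open scoped ENNReal

/-! ### From families to a length: the error bound at a bit-vector input -/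

/-- The error bound of a probabilistic family at an input given as a bit vector `u : Fin N → Bool`
(transport along `|ofFn u| = N`). [folklore] -/
theorem PFamilyAE.toOuterMeasure_ofFn_le {ε : ℕ → ℝ≥0∞} {F : (n : ℕ) → PMF (Circuit (Fin n))}
    {L : Language Bool}
    (hF : ∀ x : List Bool,
      (F x.length).toOuterMeasure {C | C.eval x.get ≠ L.boolIndicator x} ≤ ε x.length)
    {N : ℕ} (u : Fin N → Bool) :
    (F N).toOuterMeasure {C | C.eval u ≠ L.boolIndicator (List.ofFn u)} ≤ ε N := by
  have key : ∀ (z : List Bool) (N : ℕ) (hz : z.length = N),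
      (F N).toOuterMeasure
        {C : Circuit (Fin N) | C.eval (fun i => z.get (i.cast hz.symm)) ≠ L.boolIndicator z} ≤
        ε N := by
    rintro z _ rfl
    exact hF z
  have := key (List.ofFn u) N (List.length_ofFn ..)
  simpa using this

/-! ### The family lower bound for `MCSP[θ]` -/

/-- **`MCSP[θ]` against probabilistic circuits (family form).** If for infinitely many `n`
`2·ε(N)·N < N − log₂ count − (s(N) + 1)` (`N = 2ⁿ`, `count = (θ+1)(16(n+θ+1)²)^θ(n+θ+1)` the tree's
bound on the number of `n`-variable functions of complexity `≤ θ n`), then `MCSP[θ] ∉ PSIZEae ε s`: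
at such a length the family's distribution would contradict `PMF.card_sub_log_sub_le_of_error` with
`z` the truth table of `v ↦ v₀` (a YES instance; its fibre is `MCSP[θ] ∩ {0,1}^N`). [folklore] -/
theorem MCSPSize_not_mem_PSIZEae {θ s : ℕ → ℕ} {ε : ℕ → ℝ≥0∞}
    (h : ∃ᶠ n : ℕ in atTop, 2 * ε (2 ^ n) * ((2 ^ n : ℕ) : ℝ≥0∞) <
      ((2 ^ n - Nat.log 2 ((θ n + 1) * (16 * (n + θ n + 1) ^ 2) ^ θ n * (n + θ n + 1)) -
        (s (2 ^ n) + 1) : ℕ) : ℝ≥0∞)) :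
    MCSPSize θ ∉ ChenLiYang2022.PSIZEae ε s := by
  classical
  rintro ⟨F, ⟨n₀, hn₀⟩, hF⟩
  obtain ⟨n, hn₁, hlt⟩ := frequently_atTop.1 h (max n₀ 1)
  have hn0 : n₀ ≤ 2 ^ n := (le_max_left _ _).trans (hn₁.trans n.lt_two_pow_self.le)
  have hn1 : 1 ≤ n := (le_max_right _ _).trans hn₁
  -- the distribution at length `N = 2ⁿ` and the function it computes
  set μ : PMF (Circuit (Fin (2 ^ n))) := F (2 ^ n) with hμdef
  have hμ : ∀ C ∈ μ.support, C.IsOver B2 ∧ C.size ≤ s (2 ^ n) := fun C hC => hn₀ _ hn0 C hC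
  let f : (Fin (2 ^ n) → Bool) → Bool := fun x => (MCSPSize θ).boolIndicator (List.ofFn x)
  have herr : ∀ x, μ.toOuterMeasure {C | C.eval x ≠ f x} ≤ ε (2 ^ n) := fun x =>
    PFamilyAE.toOuterMeasure_ofFn_le hF x
  -- the function tabulated by an input (so that `tt (tbl x) = x`)
  let tbl : (Fin (2 ^ n) → Bool) → ((Fin n → Bool) → Bool) := fun x v => x (boolFunEquivFin n v)
  have htbl_inj : Function.Injective tbl := by
    intro x x' hxx'
    funext i
    have := congrFun hxx' ((boolFunEquivFin n).symm i)
    simpa [tbl] using this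
  have htbl_tt : ∀ x, truthTable (tbl x) = List.ofFn x := by
    intro x
    simp [truthTable, tbl]
  -- the YES instance `z = tt (v ↦ v₀)`
  set z : Fin (2 ^ n) → Bool := fun i => ((boolFunEquivFin n).symm i) ⟨0, hn1⟩ with hz
  have hf₀ : circuitSizeOver B2 (fun v : Fin n → Bool => v ⟨0, hn1⟩) ≤ θ n :=
    (circuitSizeOver_le_of_computes (f := fun v : Fin n → Bool => v ⟨0, hn1⟩)
      (Circuit.input (⟨0, hn1⟩ : Fin n)) (fun g hg => by cases hg) (fun _ => rfl)).trans (by simp)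
  have hz_yes : List.ofFn z ∈ MCSPSize θ := by
    rw [show List.ofFn z = truthTable (fun v : Fin n → Bool => v ⟨0, hn1⟩) from rfl,
      truthTable_mem_MCSPSize_iff]
    exact hf₀
  have hfz : f z = true := (Set.mem_iff_boolIndicator _ _).1 hz_yes
  -- the fibre of `z` is the YES slice, counted by the tree's circuit count
  have hcount : #{x : Fin (2 ^ n) → Bool | f x = f z} ≤
      (θ n + 1) * (16 * (n + θ n + 1) ^ 2) ^ θ n * (n + θ n + 1) := by
    calc #{x : Fin (2 ^ n) → Bool | f x = f z}
        ≤ #{g : (Fin n → Bool) → Bool | circuitSizeOver B2 g ≤ θ n} := by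
          refine card_le_card_of_injOn tbl (fun x hx => ?_) htbl_inj.injOn
          simp only [coe_filter, Set.mem_setOf_eq, mem_univ, true_and] at hx ⊢
          rw [hfz] at hx
          have hx' : List.ofFn x ∈ MCSPSize θ := (Set.mem_iff_boolIndicator _ _).2 hx
          rw [← htbl_tt, truthTable_mem_MCSPSize_iff] at hx'
          exact hx'
      _ ≤ (θ n + 1) * (16 * (n + θ n + 1) ^ 2) ^ θ n * (n + θ n + 1) :=
          card_filter_circuitSizeOver_le n (θ n)
  have key := PMF.card_sub_log_sub_le_of_error μ hμ herr z
  have hmono : ((2 ^ n - Nat.log 2 ((θ n + 1) * (16 * (n + θ n + 1) ^ 2) ^ θ n * (n + θ n + 1)) -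
        (s (2 ^ n) + 1) : ℕ) : ℝ≥0∞) ≤
      ((2 ^ n - Nat.log 2 #{x : Fin (2 ^ n) → Bool | f x = f z} - (s (2 ^ n) + 1) : ℕ) : ℝ≥0∞) := by
    have := Nat.log_mono_right (b := 2) hcount
    exact_mod_cast (show _ ≤ _ by omega)
  exact absurd (hmono.trans key) (not_le.2 hlt)

/-- **Real-error form.** For an error function `e ≥ 0` given as a real: if for infinitely many `n`
`2·e(N)·N + log₂ count + s(N) + 1 < N` (`N = 2ⁿ`), then `MCSP[θ] ∉ PSIZEae (ofReal ∘ e) s`.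
[folklore] -/
theorem MCSPSize_not_mem_PSIZEae_ofReal {θ s : ℕ → ℕ} {e : ℕ → ℝ} (he : ∀ N, 0 ≤ e N)
    (h : ∃ᶠ n : ℕ in atTop, 2 * e (2 ^ n) * ((2 ^ n : ℕ) : ℝ) +
      Nat.log 2 ((θ n + 1) * (16 * (n + θ n + 1) ^ 2) ^ θ n * (n + θ n + 1)) + s (2 ^ n) + 1 <
        ((2 ^ n : ℕ) : ℝ)) :
    MCSPSize θ ∉ ChenLiYang2022.PSIZEae (fun N => ENNReal.ofReal (e N)) s := by
  refine MCSPSize_not_mem_PSIZEae (h.mono fun n hn => ?_)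
  set N : ℕ := 2 ^ n with hNdef
  set cnt : ℕ := (θ n + 1) * (16 * (n + θ n + 1) ^ 2) ^ θ n * (n + θ n + 1) with hcnt
  have heN : 0 ≤ 2 * e N := by have := he N; positivity
  have hpos : 0 ≤ 2 * e N * (N : ℝ) := by positivity
  have hleN : Nat.log 2 cnt + (s N + 1) ≤ N := by
    have : (Nat.log 2 cnt : ℝ) + (s N + 1) ≤ N := by linarith
    exact_mod_cast this
  have hk : 2 * e N * (N : ℝ) < ((N - Nat.log 2 cnt - (s N + 1) : ℕ) : ℝ) := by
    rw [Nat.sub_sub, Nat.cast_sub hleN]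
    push_cast
    linarith
  have hkpos : (0 : ℝ) < ((N - Nat.log 2 cnt - (s N + 1) : ℕ) : ℝ) := hpos.trans_lt hk
  have hprod : ENNReal.ofReal (2 * e N * (N : ℝ)) = 2 * ENNReal.ofReal (e N) * (N : ℝ≥0∞) := by
    rw [ENNReal.ofReal_mul heN, ENNReal.ofReal_mul (by norm_num : (0 : ℝ) ≤ 2),
      ENNReal.ofReal_natCast, ENNReal.ofReal_ofNat]
  rw [← hprod, ← ENNReal.ofReal_natCast (N - Nat.log 2 cnt - (s N + 1))]
  exact (ENNReal.ofReal_lt_ofReal_iff hkpos).2 hk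

/-! ### Numerics of the linear regime -/

/-- `log₂` of the circuit count at threshold `⌈2^{βn}⌉` is `< (2ⁿ)^{β'} + 1` eventually, for
`0 ≤ β < β' < 1` (from `eventually_circuitCount_noBound_lt`). [folklore] -/
theorem eventually_log_circuitCount_noBound_lt {β β' : ℝ} (hβ : 0 ≤ β) (hββ' : β < β')
    (hβ'1 : β' < 1) :
    ∀ᶠ n : ℕ in atTop,
      (Nat.log 2 ((OliveiraPichSanthanam2019.noBound β n + 1) *
            (16 * (n + OliveiraPichSanthanam2019.noBound β n + 1) ^ 2) ^
              OliveiraPichSanthanam2019.noBound β n *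
          (n + OliveiraPichSanthanam2019.noBound β n + 1)) : ℝ) <
        ((2 ^ n : ℕ) : ℝ) ^ β' + 1 := by
  filter_upwards [eventually_circuitCount_noBound_lt hβ hββ' hβ'1] with n hn
  set cnt := (OliveiraPichSanthanam2019.noBound β n + 1) *
      (16 * (n + OliveiraPichSanthanam2019.noBound β n + 1) ^ 2) ^
        OliveiraPichSanthanam2019.noBound β n *
    (n + OliveiraPichSanthanam2019.noBound β n + 1) with hcnt
  set T : ℕ := ⌈((2 ^ n : ℕ) : ℝ) ^ β'⌉₊ with hT
  have hcnt0 : cnt ≠ 0 := by positivity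
  have hlog : Nat.log 2 cnt < 2 ^ n - (2 ^ n - T) - 1 := Nat.log_lt_of_lt_pow hcnt0 hn
  have hlogT : Nat.log 2 cnt < T := by omega
  have hT1 : (T : ℝ) < ((2 ^ n : ℕ) : ℝ) ^ β' + 1 := Nat.ceil_lt_add_one (by positivity)
  calc (Nat.log 2 cnt : ℝ) ≤ T := by exact_mod_cast hlogT.le
    _ < ((2 ^ n : ℕ) : ℝ) ^ β' + 1 := hT1

/-- The linear budget: for `c > 0`, `κ < 1`, `β' < 1`, eventually (in `N`)
`2·N^{−c}·N + N^{β'} + κN + 3 < N`. [folklore] -/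
theorem eventually_linear_budget {c κ β' : ℝ} (hc : 0 < c) (hκ : κ < 1) (hβ' : β' < 1) :
    ∀ᶠ N : ℕ in atTop,
      2 * ((N : ℝ) ^ c)⁻¹ * N + (N : ℝ) ^ β' + κ * N + 3 < N := by
  -- `g N = 2 N^{-c} + N^{-(1-β')} + 3 N^{-1} → 0`
  have hg : Tendsto (fun x : ℝ => 2 * x ^ (-c) + x ^ (-(1 - β')) + 3 * x ^ (-(1 : ℝ))) atTop
      (nhds 0) := by
    have h1 := (tendsto_rpow_neg_atTop hc).const_mul 2
    have h2 := tendsto_rpow_neg_atTop (show 0 < 1 - β' by linarith)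
    have h3 := (tendsto_rpow_neg_atTop (show (0 : ℝ) < 1 by norm_num)).const_mul 3
    simpa using (h1.add h2).add h3
  have hev : ∀ᶠ x : ℝ in atTop, 2 * x ^ (-c) + x ^ (-(1 - β')) + 3 * x ^ (-(1 : ℝ)) < 1 - κ :=
    (tendsto_order.1 hg).2 (1 - κ) (by linarith)
  have hevN := tendsto_natCast_atTop_atTop.eventually hev
  filter_upwards [hevN, eventually_ge_atTop 1] with N hN hN1
  have hNpos : (0 : ℝ) < N := by exact_mod_cast hN1
  have hmul := mul_lt_mul_of_pos_right hN hNpos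
  -- unfold the powers: `x^{-y} · x = x^{1-y}`
  have e1 : (N : ℝ) ^ (-c) * N = ((N : ℝ) ^ c)⁻¹ * N := by rw [Real.rpow_neg hNpos.le]
  have e2 : (N : ℝ) ^ (-(1 - β')) * N = (N : ℝ) ^ β' := by
    rw [show (N : ℝ) ^ β' = (N : ℝ) ^ (-(1 - β') + 1) by ring_nf, Real.rpow_add hNpos,
      Real.rpow_one]
  have e3 : (N : ℝ) ^ (-(1 : ℝ)) * N = 1 := by
    rw [Real.rpow_neg_one, inv_mul_cancel₀ hNpos.ne']
  have hlhs : (2 * (N : ℝ) ^ (-c) + (N : ℝ) ^ (-(1 - β')) + 3 * (N : ℝ) ^ (-(1 : ℝ))) * N =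
      2 * ((N : ℝ) ^ c)⁻¹ * N + (N : ℝ) ^ β' + 3 := by
    linear_combination 2 * e1 + e2 + 3 * e3
  rw [hlhs] at hmul
  linarith

/-- **Row R10, known column: `MCSP[θ]` has no probabilistic `B₂` circuits of `κN` gates with error
`N^{−c}`, for every `κ < 1` and every `c > 0`**, whenever eventually `θ n ≤ ⌈2^{βn}⌉` for some
`0 ≤ β < 1` (every `θ = 2^{o(n)}`): `MCSPSize θ ∉ PSIZEae (N^{−c}) ⌊κN⌋`. NEEDED
(`ChenLiYang2022.Hypothesis16`): `2N + C·N/log log N` gates, every `c`, every `C` — the gap is the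
leading constant. [folklore] -/
theorem MCSPSize_not_mem_PSIZEae_linear {θ : ℕ → ℕ} {β : ℝ} (hβ : 0 ≤ β) (hβ1 : β < 1)
    (hθ : ∀ᶠ n : ℕ in atTop, θ n ≤ OliveiraPichSanthanam2019.noBound β n) {c : ℝ} (hc : 0 < c)
    {κ : ℝ} (hκ : κ < 1) :
    MCSPSize θ ∉ ChenLiYang2022.PSIZEae (ChenLiYang2022.invPoly c) fun N => ⌊κ * N⌋₊ := by
  -- `invPoly c = ofReal ∘ (N ↦ (N^c)⁻¹)`
  have hinv : ChenLiYang2022.invPoly c = fun N : ℕ => ENNReal.ofReal (((N : ℝ) ^ c)⁻¹) := rfl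
  rw [hinv]
  refine MCSPSize_not_mem_PSIZEae_ofReal (fun N => by positivity) (Eventually.frequently ?_)
  -- parameters: `β' = (β+1)/2`, `κ⁺ = max κ 0`
  obtain ⟨hββ', hβ'1⟩ : β < (β + 1) / 2 ∧ (β + 1) / 2 < 1 := ⟨by linarith, by linarith⟩
  have hκ0 : 0 ≤ max κ 0 := le_max_right _ _
  have hκ1 : max κ 0 < 1 := max_lt hκ zero_lt_one
  have hbud := (tendsto_pow_atTop_atTop_of_one_lt (one_lt_two : (1 : ℕ) < 2)).eventually
    (eventually_linear_budget hc hκ1 hβ'1)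
  filter_upwards [hbud, eventually_log_circuitCount_noBound_lt hβ hββ' hβ'1, hθ] with n hn hlog hθn
  set N : ℕ := 2 ^ n with hN
  -- the count at `θ n` is below the count at `noBound β n`
  have hlogθ : (Nat.log 2 ((θ n + 1) * (16 * (n + θ n + 1) ^ 2) ^ θ n * (n + θ n + 1)) : ℝ) <
      (N : ℝ) ^ ((β + 1) / 2) + 1 :=
    lt_of_le_of_lt (by exact_mod_cast Nat.log_mono_right (circuitCount_mono n hθn)) hlog
  -- the floor is below `κ⁺ N`
  have hfloor : (⌊κ * (N : ℝ)⌋₊ : ℝ) ≤ max κ 0 * N := by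
    calc (⌊κ * (N : ℝ)⌋₊ : ℝ) ≤ ⌊max κ 0 * (N : ℝ)⌋₊ := by
          exact_mod_cast Nat.floor_le_floor
            (mul_le_mul_of_nonneg_right (le_max_left κ 0) (Nat.cast_nonneg N))
      _ ≤ max κ 0 * N := Nat.floor_le (by positivity)
  linarith

/-- The sublinear-deficiency budget: for `1 − c < β'`, `β'' < β'`, `β' < 1`, eventually (in `N`)
`2·N^{−c}·N + N^{β''} + 4 < N^{β'}`. [folklore] -/
theorem eventually_deficiency_budget {c β' β'' : ℝ} (hcβ' : 1 - c < β') (hβ'' : β'' < β')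
    (hβ'0 : 0 < β') :
    ∀ᶠ N : ℕ in atTop, 2 * ((N : ℝ) ^ c)⁻¹ * N + (N : ℝ) ^ β'' + 4 < (N : ℝ) ^ β' := by
  have hg : Tendsto (fun x : ℝ => 2 * x ^ (-(c + β' - 1)) + x ^ (-(β' - β'')) + 4 * x ^ (-β'))
      atTop (nhds 0) := by
    have h1 := (tendsto_rpow_neg_atTop (show 0 < c + β' - 1 by linarith)).const_mul 2
    have h2 := tendsto_rpow_neg_atTop (show 0 < β' - β'' by linarith)
    have h3 := (tendsto_rpow_neg_atTop hβ'0).const_mul 4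
    simpa using (h1.add h2).add h3
  have hev : ∀ᶠ x : ℝ in atTop,
      2 * x ^ (-(c + β' - 1)) + x ^ (-(β' - β'')) + 4 * x ^ (-β') < 1 :=
    (tendsto_order.1 hg).2 1 (by norm_num)
  have hevN := tendsto_natCast_atTop_atTop.eventually hev
  filter_upwards [hevN, eventually_ge_atTop 1] with N hN hN1
  have hNpos : (0 : ℝ) < N := by exact_mod_cast hN1
  have hNβ' : (0 : ℝ) < (N : ℝ) ^ β' := Real.rpow_pos_of_pos hNpos _
  have hmul := mul_lt_mul_of_pos_right hN hNβ'
  have e1 : (N : ℝ) ^ (-(c + β' - 1)) * (N : ℝ) ^ β' = ((N : ℝ) ^ c)⁻¹ * N := by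
    rw [← Real.rpow_add hNpos, ← Real.rpow_neg hNpos.le,
      show -(c + β' - 1) + β' = -c + 1 by ring, Real.rpow_add hNpos, Real.rpow_one]
  have e2 : (N : ℝ) ^ (-(β' - β'')) * (N : ℝ) ^ β' = (N : ℝ) ^ β'' := by
    rw [← Real.rpow_add hNpos, show -(β' - β'') + β' = β'' by ring]
  have e3 : (N : ℝ) ^ (-β') * (N : ℝ) ^ β' = 1 := by
    rw [Real.rpow_neg hNpos.le, inv_mul_cancel₀ hNβ'.ne']
  have hlhs : (2 * (N : ℝ) ^ (-(c + β' - 1)) + (N : ℝ) ^ (-(β' - β'')) + 4 * (N : ℝ) ^ (-β')) *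
        (N : ℝ) ^ β' = 2 * ((N : ℝ) ^ c)⁻¹ * N + (N : ℝ) ^ β'' + 4 := by
    linear_combination 2 * e1 + e2 + 4 * e3
  rw [hlhs, one_mul] at hmul
  exact hmul

/-- **Row R10, known column, sublinear-deficiency form: `MCSP[θ] ∉ PSIZEae (N^{−c}) (N − ⌈N^{β'}⌉)`
for every `β'` with `max β (1 − c) < β' < 1`** (`θ n ≤ ⌈2^{βn}⌉` eventually, `0 ≤ β`; the
hypotheses force `β < 1` and `c > 0`):
with error `N^{−c}` the averaging loses `2N^{1−c}` coordinates, whence the `1 − c`; for `c ≥ 1 − β`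
this is the same deficiency as the deterministic cell `MCSPSize_not_mem_SIZEae_sublinear`.
[folklore] -/
theorem MCSPSize_not_mem_PSIZEae_sublinear {θ : ℕ → ℕ} {β : ℝ} (hβ : 0 ≤ β)
    (hθ : ∀ᶠ n : ℕ in atTop, θ n ≤ OliveiraPichSanthanam2019.noBound β n) {c β' : ℝ}
    (hββ' : β < β') (hcβ' : 1 - c < β') (hβ'1 : β' < 1) :
    MCSPSize θ ∉
      ChenLiYang2022.PSIZEae (ChenLiYang2022.invPoly c) fun N => N - ⌈(N : ℝ) ^ β'⌉₊ := by
  have hinv : ChenLiYang2022.invPoly c = fun N : ℕ => ENNReal.ofReal (((N : ℝ) ^ c)⁻¹) := rfl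
  rw [hinv]
  refine MCSPSize_not_mem_PSIZEae_ofReal (fun N => by positivity) (Eventually.frequently ?_)
  -- parameters: `β'' = (β + β')/2`
  obtain ⟨hββ'', hβ''β'⟩ : β < (β + β') / 2 ∧ (β + β') / 2 < β' := ⟨by linarith, by linarith⟩
  have hβ'0 : 0 < β' := hβ.trans_lt hββ'
  have hbud := (tendsto_pow_atTop_atTop_of_one_lt (one_lt_two : (1 : ℕ) < 2)).eventually
    ((eventually_deficiency_budget hcβ' hβ''β' hβ'0).and (eventually_ge_atTop 1))
  filter_upwards [hbud, eventually_log_circuitCount_noBound_lt hβ hββ'' (hβ''β'.trans hβ'1), hθ]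
    with n hn hlog hθn
  obtain ⟨hn, hN1⟩ := hn
  set N : ℕ := 2 ^ n with hN
  have hlogθ : (Nat.log 2 ((θ n + 1) * (16 * (n + θ n + 1) ^ 2) ^ θ n * (n + θ n + 1)) : ℝ) <
      (N : ℝ) ^ ((β + β') / 2) + 1 :=
    lt_of_le_of_lt (by exact_mod_cast Nat.log_mono_right (circuitCount_mono n hθn)) hlog
  -- `⌈N^{β'}⌉ ≤ N`, so the budget is an honest subtraction
  have hN1' : (1 : ℝ) ≤ N := by exact_mod_cast hN1
  have hceil : ⌈(N : ℝ) ^ β'⌉₊ ≤ N := by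
    refine Nat.ceil_le.2 ?_
    calc (N : ℝ) ^ β' ≤ (N : ℝ) ^ (1 : ℝ) := Real.rpow_le_rpow_of_exponent_le hN1' hβ'1.le
      _ = N := Real.rpow_one _
  have hsub : ((N - ⌈(N : ℝ) ^ β'⌉₊ : ℕ) : ℝ) = N - ⌈(N : ℝ) ^ β'⌉₊ := Nat.cast_sub hceil
  have hceil' : (N : ℝ) ^ β' ≤ ⌈(N : ℝ) ^ β'⌉₊ := Nat.le_ceil _
  rw [hsub]
  linarith

end Literature.Computability.MetaComplexity
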